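import Summits.ABC.IUTFork.Conditional.AbcOfSHwBadMDeepOfLinUniform
import Summits.ABC.IUTFork.Conditional.AbcOfSGenuineMLinUniformTriple
import HarnessLib

/-!
# M line: every [LIN]-refuted abc-TRIPLE row, and every row of the M LIN-UNIFORM HARVEST TABLE, is M-DEEP

PROOF-ONLY intake junction (no `def`, no new `Prop`, no instance) of the abc-iut cell, seat abc-iut-C-cert-3 (gen 3; intake /
end-to-end certificate maintainer; rung LADDER-ABC:A2.C). Sequel of this seat's `AbcOfSHwBadMDeepOfLinUniform`
(`GenuineM.exists_deep_ratPoint_of_linUniform`, the rational-point form). TAKES NO SIDE on [IUTchIII] Cor. 3.12 or on any author.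

WHAT IT CERTIFIES. The row «W:LINU-HARVEST» (abc-iut-w6-d108) refutes the hull-level clause S_H at the M-level sharp setting at
1,870 (known abc triple, l) rows through ONE table master `GenuineM.not_pilotKummerCompatHull_triple_of_linUniform_table`, itself a
one-line instance of abc-iut-w5-d107's `GenuineM.not_pilotKummerCompatHull_triple_of_linUniform`. The two theorems below take EXACTLY
the binder lists of those two theorems (triple form: `habc … htest`; table form: `habc {p} tab htab {l} hl T u hu`, texts copied from
the tree) and conclude the DEPTH ANTECEDENT of the M window binders (`hSHwBad_M` of `abc_of_SH_orNum_M` p453767 / `abc_of_SH_v10M_window`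
p445989 / the θ-cut p461893), text VERBATIM as exported by `GenuineM.exists_deep_ratPoint_of_linUniform`: there is an M-deep
`(u, i, x₀)`. CONSEQUENCE FOR THE BOOKS (plan/conditional/CERTS.tsv): at every (datum, l) decided by the M harvest the M WINDOW binder is
NOT ENGAGED (its shallowness hypothesis fails there); what those rows engage is the depth-free M number binder `hNumBad_M`. The M window
family can become a composition record only through a SHALLOW-compatible (tame-exact) M row — none is in the tree (C-cert-3 author's
correction 2026-08-26 21:42Z, now certified for the whole harvest by name).

* `GenuineM.exists_deep_triple_of_linUniform` — triple form (`p^v ∣ abc`, depth `h = 2v` from abc-iut-S6's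
  `Cor22.neg_ord_jInv_ratPoint_triple`, the same `obtain` as in `AbcOfSGenuineMLinUniformTriple`).
* `GenuineM.exists_deep_of_linUniform_table` — table form (binder list of the harvest master VERBATIM).

HONEST SCOPE: nothing here refutes or proves any certificate hypothesis; admissibility / Szpiro-badness / (P6) / non-emptiness of the
genuine data NOT claimed; «refuted as typed» ≠ «refuted in print»; typed ≠ proved; instantiated ≠ endorsed; no abc claim.
[cite: Mochizuki2012, IUTchIII Cor. 3.12 Step (xi-f) p. 184; IUTchIV Cor. 2.2 (ii) proof p. 44–46] [cite: MochizukiGenEll2010, Thm. 2.1 p. 11]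
[claim: Mochizuki2012, status: disputed] for every IUT sentence quoted.
-/

noncomputable section

open Set Function NumberField IsDedekindDomain

namespace Summit.ABC.IUTFork.Conditional

open Thm311 Thm311.Real Cor312 Cor312Vol Cor312Prov Literature.IUT.LogThetaLattice Literature.IUT.LogVolume
  Literature.IUT.HodgeTheaters Literature.IUT.LogVolume.ThetaData Literature.IUT.LogVolume.Cor22
open Literature.NumberTheory.NumberFields Literature.NumberTheory.GaloisRepresentations.Ultrametric
open Literature.NumberTheory.DiophantineGeometry Literature.NumberTheory.DiophantineGeometry.GenEll Summit.ABC.ABC.Theorems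

/-- **M line, abc-TRIPLE form: a [LIN]-decided row is M-DEEP.** Under EXACTLY the hypotheses of
`GenuineM.not_pilotKummerCompatHull_triple_of_linUniform` (`a + b = c` coprime, `u` over `p ∉ {2,3,5,l}`, `30·l < p^B·(p−1)`,
`p^v ∣ abc` with `1 ≤ v`, a label `i₀ + 1 ≤ l⋆` passing the [LIN] test) every genuine Θ-volume datum `T` over `(ratPoint (a/c), l)`
has an M-deep `(u, i, x₀)` — the depth antecedent of the M window binder, VERBATIM. Proof: the pole order of `j(a/c)` at `p` is
`≤ −2v` (abc-iut-S6 `Cor22.neg_ord_jInv_ratPoint_triple`, adapted from `AbcOfSGenuineMLinUniformTriple`), then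
`GenuineM.exists_deep_ratPoint_of_linUniform` with `h = 2v`.
[cite: MochizukiGenEll2010, Thm. 2.1 p. 11] [cite: Mochizuki2012, IUTchIV Cor. 2.2 (ii) proof p. 44] [claim: Mochizuki2012, status: disputed] -/
theorem GenuineM.exists_deep_triple_of_linUniform {a b c : ℕ} (habc : IsABCTriple a b c) {l : ℕ}
    (T : Cor22.ThetaVolumeDatumAt (ratPoint ((a : ℚ) / c)) l) (u : FinitePlace ℚ) (hp2 : ratChar u ≠ 2) (hp3 : ratChar u ≠ 3)
    (hp5 : ratChar u ≠ 5) (hpl : ratChar u ≠ l) (B : ℕ) (hB : 30 * l < ratChar u ^ B * (ratChar u - 1)) (v : ℕ) (hv : 1 ≤ v)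
    (hdvd : ratChar u ^ v ∣ a * b * c) (i₀ : ℕ) (hil : i₀ + 1 ≤ (l - 1) / 2)
    (htest : 2 * l * ((i₀ + 2) * ((B + 1) * (ratChar u - 2) + 1) + (ratChar u - 2)) ≤ 2 * v * (i₀ * (i₀ + 2)) * (ratChar u - 2)) :
    letI := T.instFieldF; letI := T.instNumberFieldF; letI := T.instAlgebraF; letI := T.instFieldK
    letI := T.instNumberFieldK; letI := T.instAlgebraK; letI := T.instFieldFbar; letI := T.instAlgebraFbar
    letI := T.instAlgebraKFbar; letI := T.instIsElliptic
    ∃ (u : FinitePlace ℚ) (i : Fin (thetaIndexOfInitial T.D).lstar) (x₀ : (thetaIndexOfInitial T.D).Fibre (Val.non u)),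
        ((ratChar u : ℕ) : ℝ) ^ ((((i : ℕ) : ℝ) + 2) *
        (differentOrd (ratChar u) (kOfM T.D (ratChar u) u (natCast_ratChar_mem u) x₀)
        + logRadiusA (ratChar u) (absRamificationIdx (ratChar u) (kOfM T.D (ratChar u) u (natCast_ratChar_mem u) x₀))
        + logRadiusB (ratChar u) (absRamificationIdx (ratChar u) (kOfM T.D (ratChar u) u (natCast_ratChar_mem u) x₀))) + 1) *
        ‖tqM T.D (ratChar u) u (natCast_ratChar_mem u) (ideleDataOf T.D T.isVolumeInputOf) x₀‖ ^ (((i : ℕ) + 1) ^ 2 - 1) < 1 := by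
  -- adapted from `AbcOfSGenuineMLinUniformTriple` (abc-iut-w5-d107): pole order `≥ 2·v_p(abc)` at `p ∣ abc`
  have hp : (ratChar u).Prime := (inferInstance : Fact (ratChar u).Prime).out
  have habc0 : a * b * c ≠ 0 := by
    obtain ⟨ha, hb, hsum, -⟩ := habc
    exact Nat.mul_ne_zero (Nat.mul_ne_zero ha.ne' hb.ne') (by omega)
  have hvle : v ≤ (a * b * c).factorization (ratChar u) := (hp.pow_dvd_iff_le_factorization habc0).1 hdvd
  have hord : ∀ u' : HeightOneSpectrum (𝓞 ℚ), Rat.HeightOneSpectrum.natGenerator u' = ratChar u →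
      ord ℚ u' (Cor22.jInv ((a : ℚ) / c)) ≤ -((2 * v : ℕ) : ℤ) := by
    intro u' hu'
    have hdvd1 : Rat.HeightOneSpectrum.natGenerator u' ∣ a * b * c := by
      rw [hu']; exact (dvd_pow_self _ (by omega)).trans hdvd
    have h2 := Cor22.neg_ord_jInv_ratPoint_triple habc u' (by rw [hu']; exact hp2) hdvd1
    rw [hu'] at h2
    push_cast at h2 ⊢
    have : (v : ℤ) ≤ ((a * b * c).factorization (ratChar u) : ℤ) := by exact_mod_cast hvle
    linarith
  exact GenuineM.exists_deep_ratPoint_of_linUniform T u hp2 hp3 hp5 hpl B hB (2 * v) (by omega) hord i₀ hil htest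

/-- **M line, HARVEST-TABLE form: every row of the M LIN-UNIFORM harvest is M-DEEP.** Under EXACTLY the binder list of
abc-iut-w6-d108's table master `GenuineM.not_pilotKummerCompatHull_triple_of_linUniform_table` (`habc`, the pole prime `p`, the row
table `tab` of `(l, p, v, B, i₀)` with its arithmetic side conditions `htab`, `l ∈ tab.map Prod.fst`, a genuine `T` over
`(ratPoint (a/c), l)`, a finite place `u` with `ratChar u = p`) there is an M-deep `(u, i, x₀)` for `T` — so at every one of the
1,870 (datum, l) rows refuted by the M harvest the M WINDOW binder's shallowness hypothesis FAILS: those rows engage `hNumBad_M`, never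
`hSHwBad_M`. One `obtain` on the row, then the triple form.
[cite: MochizukiGenEll2010, Thm. 2.1 p. 11] [cite: Mochizuki2012, IUTchIV Cor. 2.2 (ii) proof p. 44] [claim: Mochizuki2012, status: disputed] -/
theorem GenuineM.exists_deep_of_linUniform_table {a b c : ℕ} (habc : IsABCTriple a b c)
    {p : ℕ} (tab : List (ℕ × ℕ × ℕ × ℕ × ℕ))
    (htab : ∀ r ∈ tab, r.2.1 = p ∧ Nat.Prime r.2.1 ∧ r.2.1 ≠ 2 ∧ r.2.1 ≠ 3 ∧ r.2.1 ≠ 5 ∧ r.2.1 ≠ r.1 ∧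
      30 * r.1 < r.2.1 ^ r.2.2.2.1 * (r.2.1 - 1) ∧ 1 ≤ r.2.2.1 ∧ r.2.1 ^ r.2.2.1 ∣ a * b * c ∧
      r.2.2.2.2 + 1 ≤ (r.1 - 1) / 2 ∧
      2 * r.1 * ((r.2.2.2.2 + 2) * ((r.2.2.2.1 + 1) * (r.2.1 - 2) + 1) + (r.2.1 - 2)) ≤
        2 * r.2.2.1 * (r.2.2.2.2 * (r.2.2.2.2 + 2)) * (r.2.1 - 2))
    {l : ℕ} (hl : l ∈ tab.map Prod.fst) (T : Cor22.ThetaVolumeDatumAt (ratPoint ((a : ℚ) / c)) l)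
    (u : FinitePlace ℚ) (hu : ratChar u = p) :
    letI := T.instFieldF; letI := T.instNumberFieldF; letI := T.instAlgebraF; letI := T.instFieldK
    letI := T.instNumberFieldK; letI := T.instAlgebraK; letI := T.instFieldFbar; letI := T.instAlgebraFbar
    letI := T.instAlgebraKFbar; letI := T.instIsElliptic
    ∃ (u : FinitePlace ℚ) (i : Fin (thetaIndexOfInitial T.D).lstar) (x₀ : (thetaIndexOfInitial T.D).Fibre (Val.non u)),
        ((ratChar u : ℕ) : ℝ) ^ ((((i : ℕ) : ℝ) + 2) *
        (differentOrd (ratChar u) (kOfM T.D (ratChar u) u (natCast_ratChar_mem u) x₀)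
        + logRadiusA (ratChar u) (absRamificationIdx (ratChar u) (kOfM T.D (ratChar u) u (natCast_ratChar_mem u) x₀))
        + logRadiusB (ratChar u) (absRamificationIdx (ratChar u) (kOfM T.D (ratChar u) u (natCast_ratChar_mem u) x₀))) + 1) *
        ‖tqM T.D (ratChar u) u (natCast_ratChar_mem u) (ideleDataOf T.D T.isVolumeInputOf) x₀‖ ^ (((i : ℕ) + 1) ^ 2 - 1) < 1 := by
  obtain ⟨r, hr, hrl⟩ := List.mem_map.1 hl
  obtain ⟨hrp, -, h2, h3, h5, hpl, hB, hv, hdvd, hil, htest⟩ := htab r hr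
  subst hrl
  have hru : ratChar u = r.2.1 := hu.trans hrp.symm
  rw [← hru] at h2 h3 h5 hpl hB hdvd htest
  exact GenuineM.exists_deep_triple_of_linUniform habc T u h2 h3 h5 hpl _ hB _ hv hdvd _ hil htest

/--
info: 'Summit.ABC.IUTFork.Conditional.GenuineM.exists_deep_triple_of_linUniform' depends on axioms: [propext,
 Classical.choice,
 Quot.sound]
-/
#guard_msgs in
#print axioms GenuineM.exists_deep_triple_of_linUniform

end Summit.ABC.IUTFork.Conditional
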